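import Mathlib
import HarnessLib
import Summits.CriticalPhenomena.Ising3DConformalLimit.Theorems.PrecisionLaplacianInverseMFerromagnetImNonadjOfLaw2Aux

/-!
# Crux `PrecisionLaplacian.InverseMFerromagnet` (stmt-CriticalPhenomena-4798), line `Sketch` —
# stub `helper_db_glue_ineq` (core D, series–parallel programme D8: the 2-sum glue inequality)

THEOREM-ONLY file (no definitions), pure real analysis.  Write `c := k₀ + a + b`, `ρ := tanh c`
and `f(t) := t / (1 + t² − 2ρt)`.  The glue inequality of the series–parallel reduction reads

  `P ≤ −f(tanh (k₀+b))`, `Q ≤ −f(tanh (k₀+a))` ⟹ `P + Q + ρ/(1 − ρ²) ≤ −f(tanh k₀)`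

for `k₀, a, b ≥ 0`.  KEY IDENTITY (`glue_f`): for every real `u`,

  `f(tanh u) = (cosh c / 2) · (sinh c + cosh c · tanh (2u − c))`,

because `1 + tanh² u − 2 tanh c tanh u = cosh (2u − c) / (cosh² u · cosh c)` (`glue_denom`) and
`sinh 2u = sinh (2u − c) cosh c + cosh (2u − c) sinh c`; also `ρ/(1 − ρ²) = sinh c cosh c`
(`glue_rho`).  With `2(k₀+b) − c = k₀ − a + b`, `2(k₀+a) − c = k₀ + a − b`, `2k₀ − c = k₀ − a − b`
the `sinh c` terms cancel and the claim becomes `cosh² c / 2` times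
`tanh (k₀+a+b) + tanh (k₀−a−b) ≤ tanh (k₀+a−b) + tanh (k₀−a+b)`, which is `c2_kappa`.
-/

namespace Summit.CriticalPhenomena.Ising3DConformalLimit.Cruxes.InverseMFerromagnet.PartialCovarianceLadder

open Literature.Probability.LatticeModels Finset Matrix

/-- The denominator of `f(tanh u)`: `1 + tanh² u − 2 tanh c tanh u = cosh (2u − c)/(cosh² u cosh c)`;
in particular it is positive. [folklore] -/
theorem glue_denom (u c : ℝ) :
    1 + Real.tanh u ^ 2 - 2 * Real.tanh c * Real.tanh u
      = Real.cosh (2 * u - c) / (Real.cosh u ^ 2 * Real.cosh c) := by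
  have hu : Real.cosh u ≠ 0 := (Real.cosh_pos u).ne'
  have hc : Real.cosh c ≠ 0 := (Real.cosh_pos c).ne'
  rw [Real.tanh_eq_sinh_div_cosh, Real.tanh_eq_sinh_div_cosh, Real.cosh_sub, Real.cosh_two_mul,
    Real.sinh_two_mul]
  field_simp

/-- KEY IDENTITY: `tanh u / (1 + tanh² u − 2 tanh c tanh u) = (cosh c / 2)(sinh c + cosh c tanh (2u − c))`.
[folklore] -/
theorem glue_f (u c : ℝ) :
    Real.tanh u / (1 + Real.tanh u ^ 2 - 2 * Real.tanh c * Real.tanh u)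
      = Real.cosh c / 2 * (Real.sinh c + Real.cosh c * Real.tanh (2 * u - c)) := by
  rw [glue_denom]
  have hu : Real.cosh u ≠ 0 := (Real.cosh_pos u).ne'
  have hc : Real.cosh c ≠ 0 := (Real.cosh_pos c).ne'
  have h2 : Real.cosh (2 * u - c) ≠ 0 := (Real.cosh_pos _).ne'
  rw [Real.tanh_eq_sinh_div_cosh, Real.tanh_eq_sinh_div_cosh]
  field_simp
  rw [Real.cosh_sub, Real.sinh_sub, Real.cosh_two_mul, Real.sinh_two_mul]
  linear_combination (-(2 * Real.sinh u * Real.cosh u)) * Real.cosh_sq_sub_sinh_sq c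

/-- `tanh c / (1 − tanh² c) = sinh c cosh c`. [folklore] -/
theorem glue_rho (c : ℝ) :
    Real.tanh c / (1 - Real.tanh c ^ 2) = Real.sinh c * Real.cosh c := by
  have hc : Real.cosh c ≠ 0 := (Real.cosh_pos c).ne'
  have h1 : 1 - Real.tanh c ^ 2 = 1 / Real.cosh c ^ 2 := by
    rw [Real.tanh_eq_sinh_div_cosh]
    field_simp
    linear_combination Real.cosh_sq_sub_sinh_sq c
  rw [h1, Real.tanh_eq_sinh_div_cosh]
  field_simp

/-- **The glue inequality** (series–parallel programme, step D8).  For `k₀, a, b ≥ 0`, with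
`ρ := tanh (k₀+a+b)` and `f(t) := t/(1 + t² − 2ρt)`: if `P ≤ −f(tanh (k₀+b))` and
`Q ≤ −f(tanh (k₀+a))` then `P + Q + ρ/(1 − ρ²) ≤ −f(tanh k₀)`.  After `glue_f`/`glue_rho` this is
`cosh² (k₀+a+b) / 2` times `c2_kappa`. [folklore] -/
theorem helper_db_glue_ineq :
    ∀ (k₀ a b P Q : ℝ), 0 ≤ k₀ → 0 ≤ a → 0 ≤ b →
      P ≤ -(Real.tanh (k₀ + b)) / (1 + Real.tanh (k₀ + b) ^ 2 - 2 * Real.tanh (k₀ + a + b) * Real.tanh (k₀ + b)) →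
      Q ≤ -(Real.tanh (k₀ + a)) / (1 + Real.tanh (k₀ + a) ^ 2 - 2 * Real.tanh (k₀ + a + b) * Real.tanh (k₀ + a)) →
      P + Q + Real.tanh (k₀ + a + b) / (1 - Real.tanh (k₀ + a + b) ^ 2) ≤
        -(Real.tanh k₀) / (1 + Real.tanh k₀ ^ 2 - 2 * Real.tanh (k₀ + a + b) * Real.tanh k₀) := by
  intro k₀ a b P Q hk ha hb hP hQ
  rw [neg_div, glue_f, show 2 * (k₀ + b) - (k₀ + a + b) = k₀ - a + b by ring] at hP
  rw [neg_div, glue_f, show 2 * (k₀ + a) - (k₀ + a + b) = k₀ + a - b by ring] at hQ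
  rw [neg_div, glue_f, glue_rho, show 2 * k₀ - (k₀ + a + b) = k₀ - a - b by ring]
  have hκ := mul_le_mul_of_nonneg_left (c2_kappa hk ha hb) (sq_nonneg (Real.cosh (k₀ + a + b)))
  have hsc : Real.cosh (k₀ + a + b) * Real.sinh (k₀ + a + b)
      = Real.cosh (k₀ + a + b) ^ 2 * Real.tanh (k₀ + a + b) := by
    rw [Real.tanh_eq_sinh_div_cosh]
    field_simp [(Real.cosh_pos (k₀ + a + b)).ne']
  linarith [hκ, hsc]

end Summit.CriticalPhenomena.Ising3DConformalLimit.Cruxes.InverseMFerromagnet.PartialCovarianceLadder
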